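import Summits.CriticalPhenomena.PercolationContinuityZ3.Theorems.PercNearOneGluingNoHeavyLowerTailSunflowerProductClassStability
import HarnessLib

/-!
# `NoHeavyLowerTail` (crux stmt-CriticalPhenomena-4575), abstract sunflower cubic at LAW level: first-order stability of the product class,
# LAW-LEVEL form — `mixedLB (cells θ₁) (cells PC) ≥ 0` for every sunflower `θ₁` dominating a product-class structure

Support file (seat `prim-ineq-gen-2` gen 30; `--supports stmt-CriticalPhenomena-4575`).  Nothing is asserted about the crux; no `sorry`, no named facts,
standard axioms.  Memo: run/shared/lean/prim/prim-ineq-gen-2/LAW-REGION-GEN30.md §7.  After `…SunflowerProductClassStability` (`pc_firstOrder`,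
`mixedLB_nonneg_of_pc`): this file does the measure bookkeeping (cells of PC(W) by block independence; cells of a dominating sunflower in terms of the
promoted / lifted masses; total mass one) and states the result in the vocabulary of gen 29's pencil forms.

RESULT [this work]: `mixedLB_cells_nonneg_of_dominatesPC` — for blocks `X i` (pairwise disjoint), up-sets `W i` determined by `X i`, all parameters `< 1`,
and every sunflower of up-sets `(E 0, E 1, E 2; A)` with `W i ⊆ E i`:
  `0 ≤ mixedLB (cells p (E 0) (E 1) (E 2) A) (cells p (pcE W 0) (pcE W 1) (pcE W 2) (pcCore W))`,
where `(pcE W; pcCore W)` is the product-class sunflower `E_i⁰ = W i ∪ {≥ 2 of the W's}`.  Reading: for a structure `θ` on `{e} ∪ ι` whose deletion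
`θ∖e` is PC(W) (sections `p[e↦0] ↦ PC`, `p[e↦1] ↦ θ/e ⊇ PC`), the mixed Bernstein coefficient `⟨m₁, ∇LB(m₀)⟩` of Lemma B's slack along the pencil is
`≥ 0` while `LB(m₀) = 0`: the B-branch of `LawPolarizedC1` (gen 29) in position `(m₁; m₀)`, and the pencil enters `{LB ≥ 0}`.
-/

noncomputable section

namespace Summit.CriticalPhenomena.PercolationContinuityZ3.Theorems.SunflowerPartition

namespace PCStability

open MeasureTheory Finset
open Literature.Probability.LatticeModels Literature.Probability.Percolation
open LawPencil

variable {ι : Type*} [Fintype ι] [DecidableEq ι]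

/-! ## The product-class sunflower as sets -/

/-- The core of PC(W): at least two of the `W i` occur. [this work] -/
def pcCore (W : Fin 3 → Set (Set ι)) : Set (Set ι) := (W 0 ∩ W 1) ∪ (W 0 ∩ W 2) ∪ (W 1 ∩ W 2)

/-- The up-sets of PC(W): `E_i⁰ = W i ∪ core`. [this work] -/
def pcE (W : Fin 3 → Set (Set ι)) (i : Fin 3) : Set (Set ι) := W i ∪ pcCore W

omit [Fintype ι] [DecidableEq ι] in
/-- PC(W) is a sunflower: pairwise intersections are the core. [this work] -/
theorem pcE_inter (W : Fin 3 → Set (Set ι)) {i j : Fin 3} (hij : i ≠ j) : pcE W i ∩ pcE W j = pcCore W := by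
  ext ω
  simp only [pcE, pcCore, Set.mem_inter_iff, Set.mem_union]
  fin_cases i <;> fin_cases j <;> simp at hij <;> tauto

omit [Fintype ι] [DecidableEq ι] in
/-- PC(W)'s up-sets are up-sets. [this work] -/
theorem isUpperSet_pcE {W : Fin 3 → Set (Set ι)} (hW : ∀ i, IsUpperSet (W i)) (i : Fin 3) : IsUpperSet (pcE W i) := by
  refine (hW i).union (((hW 0).inter (hW 1)).union ((hW 0).inter (hW 2)) |>.union ((hW 1).inter (hW 2)))

omit [Fintype ι] [DecidableEq ι] in
/-- The bottom cell of PC(W) is `pcBot`. [this work] -/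
theorem compl_union_pcE (W : Fin 3 → Set (Set ι)) : (pcE W 0 ∪ pcE W 1 ∪ pcE W 2)ᶜ = pcBot W := by
  ext ω
  simp only [pcE, pcCore, pcBot, Set.mem_compl_iff, Set.mem_union, Set.mem_inter_iff]
  tauto

omit [Fintype ι] [DecidableEq ι] in
/-- The petal cells of PC(W) are `pcPetal`. [this work] -/
theorem pcE_diff_core (W : Fin 3 → Set (Set ι)) (i : Fin 3) : pcE W i \ pcCore W = pcPetal W i := by
  ext ω
  rw [mem_pcPetal]
  simp only [pcE, pcCore, Set.mem_sdiff, Set.mem_union, Set.mem_inter_iff]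
  constructor
  · rintro ⟨h1, h2⟩
    have hi : ω ∈ W i := by tauto
    refine ⟨hi, fun l hl hl' => h2 ?_⟩
    fin_cases i <;> fin_cases l <;> simp at hl <;> tauto
  · rintro ⟨hi, h⟩
    refine ⟨Or.inl hi, ?_⟩
    fin_cases i
    · have := h 1 (by decide); have := h 2 (by decide); tauto
    · have := h 0 (by decide); have := h 2 (by decide); tauto
    · have := h 0 (by decide); have := h 1 (by decide); tauto

/-! ## Total mass one for the cells of a sunflower -/

omit [DecidableEq ι] in
/-- The five cells of a sunflower partition the cube: their masses sum to `1`. [this work] -/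
theorem cells_total (q : ι → unitInterval) {E₁ E₂ E₃ A : Set (Set ι)} (h12 : E₁ ∩ E₂ = A) (h13 : E₁ ∩ E₃ = A) (h23 : E₂ ∩ E₃ = A) :
    cells q E₁ E₂ E₃ A 0 + cells q E₁ E₂ E₃ A 1 + cells q E₁ E₂ E₃ A 2 + cells q E₁ E₂ E₃ A 3 + cells q E₁ E₂ E₃ A 4 = 1 := by
  rw [cells_apply_zero, cells_apply_one, cells_apply_two, cells_apply_three, cells_apply_four]
  set μ := prodBernoulli q
  have hA1 : A ⊆ E₁ := fun ω h => by rw [← h12] at h; exact h.1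
  have hA2 : A ⊆ E₂ := fun ω h => by rw [← h12] at h; exact h.2
  have hA3 : A ⊆ E₃ := fun ω h => by rw [← h13] at h; exact h.2
  -- (E₁ \ A) ⊔ (E₂ \ A) ⊔ (E₃ \ A) ⊔ A = E₁ ∪ E₂ ∪ E₃
  have d12 : Disjoint (E₁ \ A) (E₂ \ A) := Set.disjoint_left.2 fun ω h1 h2 => h1.2 (h12 ▸ ⟨h1.1, h2.1⟩)
  have d123 : Disjoint (E₁ \ A ∪ E₂ \ A) (E₃ \ A) := Set.disjoint_left.2 fun ω h h3 => by
    rcases h with h1 | h2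
    · exact h1.2 (h13 ▸ ⟨h1.1, h3.1⟩)
    · exact h2.2 (h23 ▸ ⟨h2.1, h3.1⟩)
  have dA : Disjoint (E₁ \ A ∪ E₂ \ A ∪ E₃ \ A) A := Set.disjoint_left.2 fun ω h hA => by
    rcases h with (h1 | h2) | h3
    · exact h1.2 hA
    · exact h2.2 hA
    · exact h3.2 hA
  have hU : E₁ \ A ∪ E₂ \ A ∪ E₃ \ A ∪ A = E₁ ∪ E₂ ∪ E₃ := by
    ext ω
    simp only [Set.mem_union, Set.mem_sdiff]
    constructor
    · rintro (((⟨h, _⟩ | ⟨h, _⟩) | ⟨h, _⟩) | h)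
      · exact Or.inl (Or.inl h)
      · exact Or.inl (Or.inr h)
      · exact Or.inr h
      · exact Or.inl (Or.inl (hA1 h))
    · intro h
      by_cases hA : ω ∈ A
      · exact Or.inr hA
      · rcases h with (h | h) | h
        · exact Or.inl (Or.inl (Or.inl ⟨h, hA⟩))
        · exact Or.inl (Or.inl (Or.inr ⟨h, hA⟩))
        · exact Or.inl (Or.inr ⟨h, hA⟩)
  have e1 := measureReal_union d12 (MeasurableSet.of_discrete (s := E₂ \ A)) (μ := μ)
  have e2 := measureReal_union d123 (MeasurableSet.of_discrete (s := E₃ \ A)) (μ := μ)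
  have e3 := measureReal_union dA (MeasurableSet.of_discrete (s := A)) (μ := μ)
  rw [hU] at e3
  have e4 : μ.real (E₁ ∪ E₂ ∪ E₃)ᶜ = 1 - μ.real (E₁ ∪ E₂ ∪ E₃) := by
    rw [measureReal_compl MeasurableSet.of_discrete, probReal_univ]
  linarith

/-! ## Cells of PC(W) by block independence -/

omit [DecidableEq ι] in
/-- A complemented event has mass `1 − μ`. [folklore] -/
theorem real_compl_eq (p : ι → unitInterval) (S : Set (Set ι)) : (prodBernoulli p).real Sᶜ = 1 - (prodBernoulli p).real S := by
  rw [measureReal_compl MeasurableSet.of_discrete, probReal_univ]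

section Blocks

variable (p : ι → unitInterval) (X : Fin 3 → Finset ι) (W : Fin 3 → Set (Set ι))
  (hWdet : ∀ i, DeterminedBy (W i) (↑(X i) : Set ι)) (hX : ∀ i j, i ≠ j → Disjoint (X i) (X j))

include hWdet hX

/-- Independence of three block events (any of them possibly complemented). [this work] -/
theorem real_inter_three {S₀ S₁ S₂ : Set (Set ι)} (h0 : DeterminedBy S₀ (↑(X 0) : Set ι)) (h1 : DeterminedBy S₁ (↑(X 1) : Set ι))
    (h2 : DeterminedBy S₂ (↑(X 2) : Set ι)) :
    (prodBernoulli p).real (S₀ ∩ S₁ ∩ S₂) = (prodBernoulli p).real S₀ * (prodBernoulli p).real S₁ * (prodBernoulli p).real S₂ := by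
  have _ := hWdet
  have h01 : DeterminedBy (S₀ ∩ S₁) (↑(X 0 ∪ X 1) : Set ι) :=
    (h0.mono (by rw [Finset.coe_union]; exact Set.subset_union_left)).inter
      (h1.mono (by rw [Finset.coe_union]; exact Set.subset_union_right))
  have hd : Disjoint (X 0 ∪ X 1) (X 2) := by
    rw [Finset.disjoint_union_left]; exact ⟨hX 0 2 (by decide), hX 1 2 (by decide)⟩
  rw [prodBernoulli_real_inter_of_determinedBy_disjoint p hd h01 h2 MeasurableSet.of_discrete MeasurableSet.of_discrete,
    prodBernoulli_real_inter_of_determinedBy_disjoint p (hX 0 1 (by decide)) h0 h1 MeasurableSet.of_discrete MeasurableSet.of_discrete]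

/-- `μ(pcBot W) = q₀ q₁ q₂`. [this work] -/
theorem real_pcBot : (prodBernoulli p).real (pcBot W) =
    (1 - (prodBernoulli p).real (W 0)) * (1 - (prodBernoulli p).real (W 1)) * (1 - (prodBernoulli p).real (W 2)) := by
  have e : pcBot W = (W 0)ᶜ ∩ (W 1)ᶜ ∩ (W 2)ᶜ := by
    ext ω; simp only [pcBot, Set.mem_compl_iff, Set.mem_union, Set.mem_inter_iff]; tauto
  rw [e, real_inter_three p X W hWdet hX (Quant.determinedBy_compl_of (hWdet 0)) (Quant.determinedBy_compl_of (hWdet 1))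
    (Quant.determinedBy_compl_of (hWdet 2)), real_compl_eq p, real_compl_eq p, real_compl_eq p]

/-- `μ(pcPetal W 0) = w₀ q₁ q₂`. [this work] -/
theorem real_pcPetal_zero : (prodBernoulli p).real (pcPetal W 0) =
    (prodBernoulli p).real (W 0) * (1 - (prodBernoulli p).real (W 1)) * (1 - (prodBernoulli p).real (W 2)) := by
  have e : pcPetal W 0 = W 0 ∩ (W 1)ᶜ ∩ (W 2)ᶜ := by
    ext ω; rw [mem_pcPetal]; simp only [Set.mem_inter_iff, Set.mem_compl_iff]
    constructor
    · rintro ⟨h, h'⟩; exact ⟨⟨h, h' 1 (by decide)⟩, h' 2 (by decide)⟩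
    · rintro ⟨⟨h, h1⟩, h2⟩; refine ⟨h, fun l hl => ?_⟩; fin_cases l <;> simp_all
  rw [e, real_inter_three p X W hWdet hX (hWdet 0) (Quant.determinedBy_compl_of (hWdet 1)) (Quant.determinedBy_compl_of (hWdet 2)),
    real_compl_eq p, real_compl_eq p]

/-- `μ(pcPetal W 1) = q₀ w₁ q₂`. [this work] -/
theorem real_pcPetal_one : (prodBernoulli p).real (pcPetal W 1) =
    (1 - (prodBernoulli p).real (W 0)) * (prodBernoulli p).real (W 1) * (1 - (prodBernoulli p).real (W 2)) := by
  have e : pcPetal W 1 = (W 0)ᶜ ∩ W 1 ∩ (W 2)ᶜ := by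
    ext ω; rw [mem_pcPetal]; simp only [Set.mem_inter_iff, Set.mem_compl_iff]
    constructor
    · rintro ⟨h, h'⟩; exact ⟨⟨h' 0 (by decide), h⟩, h' 2 (by decide)⟩
    · rintro ⟨⟨h0, h⟩, h2⟩; refine ⟨h, fun l hl => ?_⟩; fin_cases l <;> simp_all
  rw [e, real_inter_three p X W hWdet hX (Quant.determinedBy_compl_of (hWdet 0)) (hWdet 1) (Quant.determinedBy_compl_of (hWdet 2)),
    real_compl_eq p, real_compl_eq p]

/-- `μ(pcPetal W 2) = q₀ q₁ w₂`. [this work] -/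
theorem real_pcPetal_two : (prodBernoulli p).real (pcPetal W 2) =
    (1 - (prodBernoulli p).real (W 0)) * (1 - (prodBernoulli p).real (W 1)) * (prodBernoulli p).real (W 2) := by
  have e : pcPetal W 2 = (W 0)ᶜ ∩ (W 1)ᶜ ∩ W 2 := by
    ext ω; rw [mem_pcPetal]; simp only [Set.mem_inter_iff, Set.mem_compl_iff]
    constructor
    · rintro ⟨h, h'⟩; exact ⟨⟨h' 0 (by decide), h' 1 (by decide)⟩, h⟩
    · rintro ⟨⟨h0, h1⟩, h⟩; refine ⟨h, fun l hl => ?_⟩; fin_cases l <;> simp_all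
  rw [e, real_inter_three p X W hWdet hX (Quant.determinedBy_compl_of (hWdet 0)) (Quant.determinedBy_compl_of (hWdet 1)) (hWdet 2),
    real_compl_eq p, real_compl_eq p]

end Blocks

/-! ## Cells of a dominating sunflower in terms of promoted and lifted masses -/

section Dominating

variable (p : ι → unitInterval) (W : Fin 3 → Set (Set ι)) {E : Fin 3 → Set (Set ι)} {A : Set (Set ι)}
  (hEA : ∀ i j, i ≠ j → E i ∩ E j = A) (hdom : ∀ i, W i ⊆ E i)

include hEA hdom

omit [DecidableEq ι] in
/-- Bottom of the dominating sunflower: `μ((∪E)ᶜ) = μ(B⁰) − Σ_i μ(B⁰ ∩ (E i ∖ A)) − μ(B⁰ ∩ A)`. [this work] -/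
theorem real_bot_dominating :
    (prodBernoulli p).real (E 0 ∪ E 1 ∪ E 2)ᶜ = (prodBernoulli p).real (pcBot W) - (prodBernoulli p).real (pcBot W ∩ (E 0 \ A)) -
      (prodBernoulli p).real (pcBot W ∩ (E 1 \ A)) - (prodBernoulli p).real (pcBot W ∩ (E 2 \ A)) - (prodBernoulli p).real (pcBot W ∩ A) := by
  set μ := prodBernoulli p
  have hA0 : A ⊆ E 0 := fun ω h => by rw [← hEA 0 1 (by decide)] at h; exact h.1
  -- (∪E)ᶜ ⊆ B⁰ and B⁰ = (∪E)ᶜ ⊔ B⁰∩(E0∖A) ⊔ B⁰∩(E1∖A) ⊔ B⁰∩(E2∖A) ⊔ B⁰∩A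
  have hsub : (E 0 ∪ E 1 ∪ E 2)ᶜ ⊆ pcBot W := by
    intro ω hω; rw [mem_pcBot]; intro i hi
    apply hω; fin_cases i
    · exact Or.inl (Or.inl (hdom 0 hi))
    · exact Or.inl (Or.inr (hdom 1 hi))
    · exact Or.inr (hdom 2 hi)
  have d1 : Disjoint (E 0 ∪ E 1 ∪ E 2)ᶜ (pcBot W ∩ (E 0 \ A)) := Set.disjoint_left.2 fun ω h h' => h (Or.inl (Or.inl h'.2.1))
  have d2 : Disjoint ((E 0 ∪ E 1 ∪ E 2)ᶜ ∪ pcBot W ∩ (E 0 \ A)) (pcBot W ∩ (E 1 \ A)) := Set.disjoint_left.2 fun ω h h' => by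
    rcases h with h | h
    · exact h (Or.inl (Or.inr h'.2.1))
    · exact h.2.2 (by rw [← hEA 0 1 (by decide)]; exact ⟨h.2.1, h'.2.1⟩)
  have d3 : Disjoint ((E 0 ∪ E 1 ∪ E 2)ᶜ ∪ pcBot W ∩ (E 0 \ A) ∪ pcBot W ∩ (E 1 \ A)) (pcBot W ∩ (E 2 \ A)) :=
    Set.disjoint_left.2 fun ω h h' => by
      rcases h with (h | h) | h
      · exact h (Or.inr h'.2.1)
      · exact h.2.2 (by rw [← hEA 0 2 (by decide)]; exact ⟨h.2.1, h'.2.1⟩)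
      · exact h.2.2 (by rw [← hEA 1 2 (by decide)]; exact ⟨h.2.1, h'.2.1⟩)
  have d4 : Disjoint ((E 0 ∪ E 1 ∪ E 2)ᶜ ∪ pcBot W ∩ (E 0 \ A) ∪ pcBot W ∩ (E 1 \ A) ∪ pcBot W ∩ (E 2 \ A)) (pcBot W ∩ A) :=
    Set.disjoint_left.2 fun ω h h' => by
      rcases h with ((h | h) | h) | h
      · exact h (Or.inl (Or.inl (hA0 h'.2)))
      · exact h.2.2 h'.2
      · exact h.2.2 h'.2
      · exact h.2.2 h'.2
  have hU : (E 0 ∪ E 1 ∪ E 2)ᶜ ∪ pcBot W ∩ (E 0 \ A) ∪ pcBot W ∩ (E 1 \ A) ∪ pcBot W ∩ (E 2 \ A) ∪ pcBot W ∩ A = pcBot W := by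
    ext ω
    constructor
    · rintro ((((h | h) | h) | h) | h)
      · exact hsub h
      all_goals exact h.1
    · intro hb
      by_cases hA : ω ∈ A
      · exact Or.inr ⟨hb, hA⟩
      by_cases h0 : ω ∈ E 0
      · exact Or.inl (Or.inl (Or.inl (Or.inr ⟨hb, h0, hA⟩)))
      by_cases h1 : ω ∈ E 1
      · exact Or.inl (Or.inl (Or.inr ⟨hb, h1, hA⟩))
      by_cases h2 : ω ∈ E 2
      · exact Or.inl (Or.inr ⟨hb, h2, hA⟩)
      · refine Or.inl (Or.inl (Or.inl (Or.inl ?_)))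
        rintro ((h | h) | h)
        · exact h0 h
        · exact h1 h
        · exact h2 h
  have e1 := measureReal_union d1 (MeasurableSet.of_discrete (s := pcBot W ∩ (E 0 \ A))) (μ := μ)
  have e2 := measureReal_union d2 (MeasurableSet.of_discrete (s := pcBot W ∩ (E 1 \ A))) (μ := μ)
  have e3 := measureReal_union d3 (MeasurableSet.of_discrete (s := pcBot W ∩ (E 2 \ A))) (μ := μ)
  have e4 := measureReal_union d4 (MeasurableSet.of_discrete (s := pcBot W ∩ A)) (μ := μ)
  rw [hU] at e4
  linarith

omit [DecidableEq ι] in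
/-- Petal `i` of the dominating sunflower: `μ(E i ∖ A) = μ(C_i⁰) − μ(C_i⁰ ∩ A) + μ(B⁰ ∩ (E i ∖ A))`. [this work] -/
theorem real_petal_dominating (i : Fin 3) :
    (prodBernoulli p).real (E i \ A) =
      (prodBernoulli p).real (pcPetal W i) - (prodBernoulli p).real (pcPetal W i ∩ A) + (prodBernoulli p).real (pcBot W ∩ (E i \ A)) := by
  set μ := prodBernoulli p
  -- E i \ A = (pcPetal i \ A) ⊔ (pcBot ∩ (E i \ A)); pcPetal i = (pcPetal i \ A) ⊔ (pcPetal i ∩ A)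
  have hsplit1 : pcPetal W i \ A ∪ pcBot W ∩ (E i \ A) = E i \ A := by
    ext ω
    simp only [Set.mem_union, Set.mem_sdiff, Set.mem_inter_iff, mem_pcPetal, mem_pcBot]
    constructor
    · rintro (⟨⟨hi, _⟩, hA⟩ | ⟨_, hE, hA⟩)
      · exact ⟨hdom i hi, hA⟩
      · exact ⟨hE, hA⟩
    · rintro ⟨hE, hA⟩
      by_cases hWi : ω ∈ W i
      · refine Or.inl ⟨⟨hWi, fun l hl hl' => hA ?_⟩, hA⟩
        rw [← hEA l i hl]; exact ⟨hdom l hl', hE⟩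
      · refine Or.inr ⟨fun l hl' => ?_, hE, hA⟩
        by_cases hli : l = i
        · subst hli; exact hWi hl'
        · apply hA; rw [← hEA l i hli]; exact ⟨hdom l hl', hE⟩
  have hd1 : Disjoint (pcPetal W i \ A) (pcBot W ∩ (E i \ A)) :=
    Set.disjoint_left.2 fun ω h h' => (mem_pcBot.1 h'.1) i (mem_pcPetal.1 h.1).1
  have hsplit2 : pcPetal W i \ A ∪ pcPetal W i ∩ A = pcPetal W i := Set.sdiff_union_inter _ _
  have hd2 : Disjoint (pcPetal W i \ A) (pcPetal W i ∩ A) := Set.disjoint_left.2 fun ω h h' => h.2 h'.2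
  have e1 := measureReal_union hd1 (MeasurableSet.of_discrete (s := pcBot W ∩ (E i \ A))) (μ := μ)
  have e2 := measureReal_union hd2 (MeasurableSet.of_discrete (s := pcPetal W i ∩ A)) (μ := μ)
  rw [hsplit1] at e1; rw [hsplit2] at e2
  linarith

end Dominating

/-! ## The law-level theorem -/

/-- **FIRST-ORDER STABILITY OF THE PRODUCT CLASS, LAW FORM**: for every sunflower of up-sets `(E; A)` dominating PC(W) (blocks pairwise disjoint,
all parameters `< 1`), the first mixed Bernstein coefficient of Lemma B's slack along the pencil from PC(W) to `(E; A)` is nonnegative: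
`0 ≤ mixedLB (cells p E A) (cells p PC)`.  Since `LB(cells PC) = 0`, the pencil of any structure whose deletion is PC(W) enters `{LB ≥ 0}`. [this work] -/
theorem mixedLB_cells_nonneg_of_dominatesPC (p : ι → unitInterval) (X : Fin 3 → Finset ι) (W : Fin 3 → Set (Set ι))
    (hWup : ∀ i, IsUpperSet (W i)) (hWdet : ∀ i, DeterminedBy (W i) (↑(X i) : Set ι)) (hX : ∀ i j, i ≠ j → Disjoint (X i) (X j))
    {E : Fin 3 → Set (Set ι)} {A : Set (Set ι)} (hEup : ∀ i, IsUpperSet (E i)) (hEA : ∀ i j, i ≠ j → E i ∩ E j = A)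
    (hdom : ∀ i, W i ⊆ E i) (hp : ∀ i, (p i : ℝ) < 1) :
    0 ≤ mixedLB (cells p (E 0) (E 1) (E 2) A) (cells p (pcE W 0) (pcE W 1) (pcE W 2) (pcCore W)) := by
  set m₀ := cells p (pcE W 0) (pcE W 1) (pcE W 2) (pcCore W) with hm₀
  set m₁ := cells p (E 0) (E 1) (E 2) A with hm₁
  have t0 := cells_total p (pcE_inter W (show (0 : Fin 3) ≠ 1 by decide)) (pcE_inter W (show (0 : Fin 3) ≠ 2 by decide))
    (pcE_inter W (show (1 : Fin 3) ≠ 2 by decide))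
  have t1 := cells_total p (hEA 0 1 (by decide)) (hEA 0 2 (by decide)) (hEA 1 2 (by decide))
  refine mixedLB_nonneg_of_pc (fun i => (prodBernoulli p).real (W i)) (fun i => (prodBernoulli p).real (pcBot W ∩ (E i \ A)))
    (fun j => (prodBernoulli p).real (pcPetal W j ∩ A)) ((prodBernoulli p).real (pcBot W ∩ A)) m₀ m₁
    (fun i => ⟨measureReal_nonneg, measureReal_le_one⟩) ?_ ?_ ?_ ?_ ?_ ?_ ?_ ?_ ?_ ?_ ?_
  · rw [hm₀, cells_apply_zero, compl_union_pcE, real_pcBot p X W hWdet hX]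
  · rw [hm₀, cells_apply_one, pcE_diff_core, real_pcPetal_zero p X W hWdet hX]
  · rw [hm₀, cells_apply_two, pcE_diff_core, real_pcPetal_one p X W hWdet hX]
  · rw [hm₀, cells_apply_three, pcE_diff_core, real_pcPetal_two p X W hWdet hX]
  · linarith
  · rw [hm₁, hm₀, cells_apply_zero, cells_apply_zero, compl_union_pcE]
    exact real_bot_dominating p W hEA hdom
  · rw [hm₁, hm₀, cells_apply_one, cells_apply_one, pcE_diff_core]
    have := real_petal_dominating p W hEA hdom 0; linarith
  · rw [hm₁, hm₀, cells_apply_two, cells_apply_two, pcE_diff_core]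
    have := real_petal_dominating p W hEA hdom 1; linarith
  · rw [hm₁, hm₀, cells_apply_three, cells_apply_three, pcE_diff_core]
    have := real_petal_dominating p W hEA hdom 2; linarith
  · -- m₁ 4 = m₀ 4 + ΣL + PA, from the two total-mass identities and the previous four relations
    have e0 : m₁ 0 = m₀ 0 - (prodBernoulli p).real (pcBot W ∩ (E 0 \ A)) - (prodBernoulli p).real (pcBot W ∩ (E 1 \ A)) -
        (prodBernoulli p).real (pcBot W ∩ (E 2 \ A)) - (prodBernoulli p).real (pcBot W ∩ A) := by
      rw [hm₁, hm₀, cells_apply_zero, cells_apply_zero, compl_union_pcE]; exact real_bot_dominating p W hEA hdom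
    have e1 : m₁ 1 = m₀ 1 - (prodBernoulli p).real (pcPetal W 0 ∩ A) + (prodBernoulli p).real (pcBot W ∩ (E 0 \ A)) := by
      rw [hm₁, hm₀, cells_apply_one, cells_apply_one, pcE_diff_core]; exact real_petal_dominating p W hEA hdom 0
    have e2 : m₁ 2 = m₀ 2 - (prodBernoulli p).real (pcPetal W 1 ∩ A) + (prodBernoulli p).real (pcBot W ∩ (E 1 \ A)) := by
      rw [hm₁, hm₀, cells_apply_two, cells_apply_two, pcE_diff_core]; exact real_petal_dominating p W hEA hdom 1
    have e3 : m₁ 3 = m₀ 3 - (prodBernoulli p).real (pcPetal W 2 ∩ A) + (prodBernoulli p).real (pcBot W ∩ (E 2 \ A)) := by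
      rw [hm₁, hm₀, cells_apply_three, cells_apply_three, pcE_diff_core]; exact real_petal_dominating p W hEA hdom 2
    linarith
  · have h := pc_firstOrder p X W hWup hWdet hX hEup hEA hdom hp
    rw [real_compl_eq p (W 0), real_compl_eq p (W 1), real_compl_eq p (W 2)] at h
    exact h

end PCStability

end Summit.CriticalPhenomena.PercolationContinuityZ3.Theorems.SunflowerPartition
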